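import Summits.Ventures.PercRepro.ThetaSigmaDense

/-!
# (Σ) reduces to the DENSE instances — the reduction theorem

Dossier proofs/MINE1-theoremS.md, Addendum 79 (mine-1, gen 40). With the partner vocabulary and
the projection lemmas of `ThetaSigmaDense.lean`:

* `exists_orient_of_atMostOnePartner` — **a point with at most one partner pair is good with no
  classification**: for a valid instance with `∅, U ∉ X` and at least three members, a point
  `e ∈ U` with at most one partner pair has an orientation `T` of its projection (the projection
  itself, or the projection minus one member of the co-pair / co-co-pair) with
  `|projS e X| + |partS e X| ≤ |T| + |creditS U e X|` — the one consistent pair is paid by any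
  third member (`one_le_card_creditS_of_partner`), the one co-pair or co-co-pair by `∅ ∈ creditS`
  (`empty_mem_creditS_of_copair` / `_of_cocopair`);
* `SigmaCreditLemmaDense α` — the Credit Lemma restricted to the DENSE instances (every point
  carries at least two partner pairs; `∅, U ∉ X`, `|X| ≥ 3`), and
  **`conjSigma_of_denseCreditLemma`**: it implies Conjecture (Σ) (induction on the ground set:
  `sigmaValidRel_card_le_of_denseCreditLemma`). So (Σ) is equivalent to its dense case, where the
  slack is ≥ 4 on five points (Addendum 79).
-/

namespace PercRepro.MSTight

open Finset

variable {α : Type*} [DecidableEq α]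

section Orient

variable {U : Finset α} {e : α} {X : Finset (Finset α)}

/-- **A point with at most one partner pair is good**: for a valid instance with `∅, U ∉ X` and
at least three members, a point `e ∈ U` with at most one partner pair has an orientation `T` of
its projection whose partners are paid by the credit. -/
theorem exists_orient_of_atMostOnePartner (hv : SigmaValidRel U X) (hU : e ∈ U)
    (h0 : (∅ : Finset α) ∉ X) (hUX : U ∉ X) (h3 : 3 ≤ X.card)
    (h : AtMostOnePartnerAt U e X) :
    ∃ T ⊆ projS e X, Disjoint T (complsRel (U.erase e) T) ∧
      (projS e X).card + (partS e X).card ≤ T.card + (creditS U e X).card := by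
  rcases h with ⟨hp, hc, hcc⟩ | ⟨hp, hc, hcc⟩ | ⟨hp, hc, hcc⟩
  · -- (i) a sign-consistent point with at most one consistent pair
    refine ⟨projS e X, Subset.refl _, (sigmaValidRel_projS hv
      (sigmaConsistentAt_of_no_copair hv hc hcc)).2, ?_⟩
    rcases Nat.eq_zero_or_pos (partS e X).card with hz | hpos
    · rw [hz]
      omega
    · have h1 : (partS e X).card = 1 := by omega
      obtain ⟨x, hKx⟩ := card_eq_one.1 h1
      have hx : x ∈ partS e X := by rw [hKx]; exact mem_singleton_self x
      have hx' := mem_partS.1 hx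
      have hlt : ({x, insert e x} : Finset (Finset α)).card < X.card := by
        have := card_le_two (a := x) (b := insert e x)
        omega
      obtain ⟨y, hy, hy'⟩ := exists_mem_notMem_of_card_lt_card hlt
      simp only [mem_insert, mem_singleton, not_or] at hy'
      have := one_le_card_creditS_of_partner hU hx hy hy'.1 hy'.2
      omega
  · -- (ii) at most one co-pair and nothing else
    rcases Nat.eq_zero_or_pos (copairMembersAt U e X).card with hz | hpos
    · -- no co-pair at all: consistent, no partners
      rw [card_eq_zero] at hz
      refine ⟨projS e X, Subset.refl _, (sigmaValidRel_projS hv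
        (sigmaConsistentAt_of_no_copair hv hz hcc)).2, ?_⟩
      rw [hp, card_empty]
      omega
    · obtain ⟨x, hx⟩ := card_pos.1 hpos
      have hxU := hv.1 x (mem_copairMembersAt.1 hx).1
      have hx' := sdiff_mem_copairMembersAt hxU hx
      have hne := ne_sdiff_of_mem_copairMembersAt h0 hx
      -- the co-pair members are exactly `{x, U ∖ e ∖ x}`
      have hmem : ∀ s ∈ copairMembersAt U e X, s = x ∨ s = U.erase e \ x := by
        intro s hs
        by_contra hcon
        have hsub : ({x, U.erase e \ x, s} : Finset (Finset α)) ⊆ copairMembersAt U e X := by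
          intro t ht
          simp only [mem_insert, mem_singleton] at ht
          rcases ht with rfl | rfl | rfl
          · exact hx
          · exact hx'
          · exact hs
        have h3' : ({x, U.erase e \ x, s} : Finset (Finset α)).card = 3 := by
          rw [card_insert_of_notMem, card_pair]
          · intro h
            exact hcon (Or.inr h.symm)
          · simp only [mem_insert, mem_singleton, not_or]
            exact ⟨hne, fun h => hcon (Or.inl h.symm)⟩
        have := card_le_card hsub
        omega
      have hw : ∀ s ∈ projS e X, U.erase e \ s ∈ projS e X → s = x ∨ s = U.erase e \ x := by
        intro s hs hs'
        rcases copair_or_cocopair_of_mem_projS hv hU hs hs' with h | h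
        · exact hmem s h
        · rw [hcc] at h
          exact absurd h (notMem_empty _)
      refine ⟨(projS e X).erase (U.erase e \ x), erase_subset _ _,
        disjoint_complsRel_erase_of_unique x hw, ?_⟩
      have hxP := mem_projS_of_mem_copairMembersAt hx'
      rw [card_erase_of_mem hxP, hp, card_empty]
      have hcr : 1 ≤ (creditS U e X).card := by
        apply card_pos.2
        refine ⟨∅, empty_mem_creditS_of_copair hU (mem_copairMembersAt.1 hx).1
          (mem_copairMembersAt.1 hx').1 hne ?_⟩
        rw [sup_eq_union, union_sdiff_self_eq_union, union_eq_right.2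
          (subset_erase.2 ⟨hxU, (mem_copairMembersAt.1 hx).2.1⟩)]
      have hpos' : 0 < (projS e X).card := card_pos.2 ⟨_, hxP⟩
      omega
  · -- (iii) at most one co-co-pair and nothing else
    rcases Nat.eq_zero_or_pos (cocopairMembersAt U e X).card with hz | hpos
    · rw [card_eq_zero] at hz
      refine ⟨projS e X, Subset.refl _, (sigmaValidRel_projS hv
        (sigmaConsistentAt_of_no_copair hv hc hz)).2, ?_⟩
      rw [hp, card_empty]
      omega
    · obtain ⟨z, hz⟩ := card_pos.1 hpos
      have hzU := hv.1 z (mem_cocopairMembersAt.1 hz).1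
      have hez := (mem_cocopairMembersAt.1 hz).2.1
      have hz' := insert_sdiff_mem_cocopairMembersAt hzU hz
      have hne := ne_insert_sdiff_of_mem_cocopairMembersAt hUX hzU hz
      have hmem : ∀ s ∈ cocopairMembersAt U e X, s = z ∨ s = insert e (U \ z) := by
        intro s hs
        by_contra hcon
        have hsub : ({z, insert e (U \ z), s} : Finset (Finset α)) ⊆ cocopairMembersAt U e X := by
          intro t ht
          simp only [mem_insert, mem_singleton] at ht
          rcases ht with rfl | rfl | rfl
          · exact hz
          · exact hz'
          · exact hs
        have h3' : ({z, insert e (U \ z), s} : Finset (Finset α)).card = 3 := by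
          rw [card_insert_of_notMem, card_pair]
          · intro h
            exact hcon (Or.inr h.symm)
          · simp only [mem_insert, mem_singleton, not_or]
            exact ⟨hne, fun h => hcon (Or.inl h.symm)⟩
        have := card_le_card hsub
        omega
      -- the projection of `z` and of its partner
      set w := z.erase e with hwdef
      have hw' : (insert e (U \ z)).erase e = U.erase e \ w := erase_insert_sdiff_eq U e z
      have hw : ∀ s ∈ projS e X, U.erase e \ s ∈ projS e X → s = w ∨ s = U.erase e \ w := by
        intro s hs hs'
        rcases copair_or_cocopair_of_mem_projS hv hU hs hs' with h | h
        · rw [hc] at h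
          exact absurd h (notMem_empty _)
        · have hes : e ∉ s := by
            obtain ⟨u, -, rfl⟩ := mem_projS.1 hs
            exact notMem_erase e u
          rcases hmem _ h with h1 | h1
          · left
            rw [hwdef, ← h1, erase_insert hes]
          · right
            rw [← hw', ← h1, erase_insert hes]
      refine ⟨(projS e X).erase (U.erase e \ w), erase_subset _ _,
        disjoint_complsRel_erase_of_unique w hw, ?_⟩
      have hwP : U.erase e \ w ∈ projS e X := by
        rw [← hw']
        exact mem_projS.2 ⟨_, (mem_cocopairMembersAt.1 hz').1, rfl⟩
      rw [card_erase_of_mem hwP, hp, card_empty]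
      have hcr : 1 ≤ (creditS U e X).card := by
        apply card_pos.2
        refine ⟨∅, empty_mem_creditS_of_cocopair (mem_cocopairMembersAt.1 hz).1
          (mem_cocopairMembersAt.1 hz').1 hne ?_⟩
        ext a
        simp only [inf_eq_inter, mem_inter, mem_insert, mem_sdiff, mem_singleton]
        constructor
        · rintro ⟨haz, h | ⟨-, haz'⟩⟩
          · exact h
          · exact absurd haz haz'
        · rintro rfl
          exact ⟨hez, Or.inl rfl⟩
      have hpos' : 0 < (projS e X).card := card_pos.2 ⟨_, hwP⟩
      omega

end Orient

section Dense

variable {U : Finset α} {X : Finset (Finset α)}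

/-- **The Credit Lemma on the dense instances**: every valid instance with `∅, U ∉ X`, at least
three members and at least two partner pairs at EVERY point of the ground set has a point and
an orientation of its projection whose partners are paid by the credit. -/
def SigmaCreditLemmaDense (α : Type*) [DecidableEq α] : Prop :=
  ∀ (U : Finset α) (X : Finset (Finset α)), SigmaValidRel U X → (∅ : Finset α) ∉ X → U ∉ X →
    3 ≤ X.card → (∀ e ∈ U, ¬ AtMostOnePartnerAt U e X) →
    ∃ e ∈ U, ∃ T ⊆ projS e X, Disjoint T (complsRel (U.erase e) T) ∧
      (projS e X).card + (partS e X).card ≤ T.card + (creditS U e X).card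

/-- Two members: `|sigmaD| ≥ 2` for a valid instance with two members. -/
theorem two_le_card_sigmaD_of_card_eq_two (hv : SigmaValidRel U X) (h2 : X.card = 2) :
    2 ≤ (sigmaD U X).card := by
  obtain ⟨x, y, hxy, hXxy⟩ := card_eq_two.1 h2
  have hx : x ∈ X := by rw [hXxy]; simp
  have hy : y ∈ X := by rw [hXxy]; simp
  have hxU := hv.1 x hx
  have hyU := hv.1 y hy
  rw [Nat.succ_le_iff, one_lt_card]
  by_cases hm : x ⊓ y = ∅
  · refine ⟨∅, empty_mem_sigmaD U X, U \ (x ⊔ y), sdiff_sup_mem_sigmaD hxy hx hy, ?_⟩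
    intro h
    have hsub : x ⊔ y ⊆ U := by
      rw [sup_eq_union]
      exact union_subset hxU hyU
    have h' : x ⊔ y = U := by
      apply Finset.Subset.antisymm hsub
      intro a ha
      by_contra hna
      have : a ∈ U \ (x ⊔ y) := mem_sdiff.2 ⟨ha, hna⟩
      rw [← h] at this
      exact notMem_empty a this
    apply sdiff_notMem_of_sigmaValidRel hv hx
    have : U \ x = y := by
      ext a
      rw [mem_sdiff]
      constructor
      · rintro ⟨haU, hax⟩
        have : a ∈ x ⊔ y := h' ▸ haU
        rw [sup_eq_union, mem_union] at this
        exact this.resolve_left hax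
      · intro hay
        refine ⟨hyU hay, fun hax => ?_⟩
        have : a ∈ x ⊓ y := mem_inter.2 ⟨hax, hay⟩
        rw [hm] at this
        exact notMem_empty a this
    rw [this]
    exact hy
  · exact ⟨∅, empty_mem_sigmaD U X, x ⊓ y, inf_mem_sigmaD hxy hx hy, fun h => hm h.symm⟩

/-- **The dense Credit Lemma implies (Σ) on every ground set**: induction on the ground set; a
point with at most one partner pair reduces without any hypothesis, the dense instances by the
hypothesis. -/
theorem sigmaValidRel_card_le_of_denseCreditLemma (h : SigmaCreditLemmaDense α) :
    ∀ (U : Finset α) (X : Finset (Finset α)), SigmaValidRel U X →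
      X.card ≤ (sigmaD U X).card := by
  intro U
  induction U using Finset.strongInduction with
  | H U ih =>
    intro X hv
    -- small and extreme instances
    rcases Nat.lt_or_ge X.card 2 with h1 | h2
    · have := card_pos.2 ⟨∅, empty_mem_sigmaD U X⟩
      omega
    rcases Nat.lt_or_ge X.card 3 with h2' | h3
    · have := two_le_card_sigmaD_of_card_eq_two hv (by omega)
      omega
    by_cases h0 : (∅ : Finset α) ∈ X
    · exact card_le_card_sigmaD_of_empty_mem hv h0
    by_cases hUX : U ∈ X
    · exact card_le_card_sigmaD_of_mem_self hv hUX
    -- the ground set is nonempty (three members)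
    have hne : U.Nonempty := by
      by_contra hemp
      rw [not_nonempty_iff_eq_empty] at hemp
      subst hemp
      have := card_le_one_of_sigmaValidRel_empty hv
      omega
    -- a point with at most one partner pair, or a dense instance
    by_cases hsparse : ∃ e ∈ U, AtMostOnePartnerAt U e X
    · obtain ⟨e, he, hat⟩ := hsparse
      obtain ⟨T, hT, hTd, hK⟩ := exists_orient_of_atMostOnePartner hv he h0 hUX h3 hat
      exact card_le_card_sigmaD_of_subset_projS hT
        (ih (U.erase e) (erase_ssubset he) T (sigmaValidRel_of_subset_projS hv hT hTd)) hK
    · have hdense : ∀ e ∈ U, ¬ AtMostOnePartnerAt U e X := by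
        intro e he hat
        exact hsparse ⟨e, he, hat⟩
      obtain ⟨e, he, T, hT, hTd, hK⟩ := h U X hv h0 hUX h3 hdense
      exact card_le_card_sigmaD_of_subset_projS hT
        (ih (U.erase e) (erase_ssubset he) T (sigmaValidRel_of_subset_projS hv hT hTd)) hK

/-- **(Σ) is equivalent to its dense case**: the dense Credit Lemma implies Conjecture (Σ). -/
theorem conjSigma_of_denseCreditLemma [Fintype α] (h : SigmaCreditLemmaDense α) : ConjSigma α :=
  fun X hv => sigmaValidRel_card_le_of_denseCreditLemma h univ X hv

end Dense

end PercRepro.MSTight
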